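import Summits.QuantumFields.YangMills.Theorems.UnitScaleTiltProp7EMLTowerCentralGeneral
import Summits.QuantumFields.YangMills.Theorems.UnitScaleTiltProp7QTwSScalarSectorRegPr
import HarnessLib

/-!
# Route `UnitScaleTilt`, crux K1 child «MinimiserStabilityRegPr» (stmt-QuantumFields-19200), stub `stub_existenceMinimalOrbit` (EX), the J-term rows of the EX knit —
# **(Q-b)⁽²⁾: THE TWISTED LOG-CHART IS ADDITIVE IN CENTRAL DIRECTIONS, SO THE CENTRAL DIRECTIONS OF PRINT'S QUADRATIC TERM `C⁽²⁾(U₀) = ½·D²(log U̿^{twS})(0)` VANISH**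
# (ym-inputs-p01 g2 12:05:39Z LOCATE, the displayed row `hAvgC` of the J-term rows; `avgHess U₀ := fderiv (fderiv logChartTwS) 0`, L0b-4 `…SectET3DeltaOneT3JTerm`):
# `log U̿^{twS}(A + (iz)·1) = log U̿^{twS}(A) + (i·Lᵏ·(Q_k z))·1` (✓`…EMLTowerCentralGeneral` + ★w8's abelian tower + `log(ι s · Y) = ι(log s) + log Y`), whence
# `D²L(0)[X, c·1] = 0 = D²L(0)[c·1, X]` by one-variable calculus (the map `A ↦ DL(A)(c·1)` is locally constant, and so is `t ↦ DL(t·c·1)`).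

Cell `ym3-torus`, width seat `ym-ust-20520-w5` (gen 5).  `--supports stmt-QuantumFields-19200 --as helper`; THEOREMS ONLY (0 `def`, 0 `sorry`); count-neutral; nothing here claims
the stub, the crux, d = 4 or the mass gap — YM₃ on T³ is a ladder rung (R3), not the Clay problem.

WHAT IS PROVED (`k := K − n`, `ℓ := (d+2)L`, `U₀♭ := bgUnits F K U₀`, `W_A := e^{A}U₀♭`, `ĉ := bondShift (sites_eq F n K h) c`, `L := logChartTwS F n K h U₀`).
* §1 (generic) `expUnit_add_smul_one_mul` (`e^{A + (iz)·1}·U = ιˣ(e^{iz})·(e^{A}·U)`, commuting exponentials); ★`fderiv_fderiv_eq_zero_of_add_eventually` — for `f` differentiable near `0` with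
  `f(x + t·v) = f(x) + f(t·v)` for `(x, t)` near `0`: `D²f(0)[u, v] = 0 = D²f(0)[v, u]` (stated on `fderiv ℂ (fun x => fderiv ℂ f x) 0`; no Schwarz needed); `abelianTower_small_sixteenth` (the
  `1∕16` form of ✓`abelianTower_small`: loops AND stairs).
* §2 (T³, displayed tower rows) ★`dbarTwS_add_central` — `U̿^{twS}(A + (iz)·1)(c) = ιˣ(U̿^{(k)}(e^{iz})(ĉ)) · U̿^{twS}(A)(c)`; ★★`logChartTwS_add_central` — `L(A + (iz)·1)(c) = L(A)(c) + (i·Lᵏ·(Q_k z)(ĉ))·1`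
  under `|z(b)| ≤ t`, `32ℓLᵏt ≤ 1`, `‖U̿^{twS}(A)(c) − 1‖ ≤ 1∕8`, and the DISPLAYED level-wise rows: loops of `dbarCovIterU j U₀♭ W_A` and twisted stairs `tstairU (Ū₀♭ʲ) (dbarCovIterU j U₀♭ W_A)`
  within `1∕8` (`j < k`) — the scalar rows are supplied (§1).
* §3 = the sibling `…QTwSCentralAdditiveRegPr` (at `U₀ ∈ 𝔘_k(ε₀)`: every row but `htower` supplied; ★★★`fderiv_fderiv_logChartTwS_smul_one_eq_zero_of_regPr`).
HONEST SCOPE.  Algebra + one-variable calculus over landed theorems; the tower rows displayed and named; nothing of [Balaban1985Averaging]∕[Balaban1985BackgroundPropagators] asserted.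

References: T. Bałaban, CMP **99** (1985) 389–434 [Balaban1985BackgroundPropagators] ((3.14)–(3.15) p.393, (3.127) p.421); CMP **98** (1985) 17–51 [Balaban1985Averaging] ((89)–(92) p.31,
(125)–(127) p.36, Prop. 4 (134)–(135) p.38, (161)–(163) p.42); CMP **95** (1984) 17–40 [Balaban1984PropagatorsI] ((1.18) p.20); CMP **102** (1985) 277–309 [Balaban1985Variational] ((44)–(47) p.285).
-/

set_option autoImplicit false

noncomputable section

open scoped Matrix.Norms.L2Operator
open Filter Topology Metric

namespace Summit.QuantumFields.YangMills.Theorems.Prop7SymAvgTwSym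

open NormedSpace
open Literature.MathematicalPhysics.QuantumFieldTheory.Balaban1983to89
open T4Continuum BlockAveraging AveragingRT ExpMeanLog MatrixLog BlockAveragingEMLLinearised LatticeFieldCalculus
open LatticeWordStokes (length_loopWord_le)
open B7BlockAvgLog (mlog_exp)
open B10Eq27TorusAxialLog (holT)
open B7Prop1Explicit (expUnit val_expUnit)
open T3ContinuumYM3Torus
open T3LevelShift (bondShift)
open T3PrintedRegularOrbits (sites_eq)
open T3PrintedRegularMinimiser (RegPr)
open T3SectALandauChart (eta eta_pos bgUnits)
open Summit.QuantumFields.YangMills.Theorems.Prop8Chart (loopHolU emlIterU expCfg)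
open Summit.QuantumFields.YangMills.Theorems.Prop8ChartDoubleBar (dbarIterU dbarIterU_coe_eq_exp_abelian)
open Summit.QuantumFields.YangMills.Theorems.Prop7CmapTwSymInputs (analyticOnNhd_logChartTwS)
open Summit.QuantumFields.YangMills.Theorems.Prop7CmapTwInputs (norm_apply_le_of_mem_ball)
open Summit.QuantumFields.YangMills.Theorems.Prop7DbarTwSymWindow (norm_dbarTwS_sub_one_le)
open Literature.MathematicalPhysics.QuantumFieldTheory.BalabanImbrieJaffe1984to88.BIJ85ContourLocality (norm_bondAvgIter_le_tower)

/-! ## §1 Generic pieces: commuting exponentials, the calculus lemma, the `1∕16` abelian tower -/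

section Generic

variable {𝔸 : Type*} [NormedRing 𝔸] [NormedAlgebra ℂ 𝔸] [CompleteSpace 𝔸]

/-- **`e^{A + (iz)·1}·U = ιˣ(e^{iz})·(e^{A}·U)`**: the central summand of the exponent factors out as a central unit (`exp` of commuting elements; `exp((iz)·1) = ι(e^{iz})`).
[cite: Balaban1985Variational, (19) p.281; Balaban1985Averaging, (8)-(9) p.19] -/
theorem expUnit_add_smul_one_mul {ι' : Type*} (A : ι' → 𝔸) (z : ι' → ℂ) (U : ι' → 𝔸ˣ) :
    (fun b => expUnit (A b + (Complex.I * z b) • (1 : 𝔸)) * U b) =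
      fun b => Units.map ((algebraMap ℂ 𝔸 : ℂ →+* 𝔸) : ℂ →* 𝔸) (expUnit (Complex.I * z b)) * (expUnit (A b) * U b) := by
  letI : NormedAlgebra ℚ 𝔸 := NormedAlgebra.restrictScalars ℚ ℂ 𝔸
  funext b
  rw [← mul_assoc]
  congr 1
  apply Units.ext
  rw [val_expUnit, Units.val_mul, Units.coe_map, MonoidHom.coe_coe, val_expUnit, val_expUnit, add_comm, ← Algebra.algebraMap_eq_smul_one,
    exp_add_of_commute (Algebra.commutes (Complex.I * z b) (A b)), algebraMap_exp_comm]

end Generic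

section Calculus

variable {E G : Type*} [NormedAddCommGroup E] [NormedSpace ℂ E] [NormedAddCommGroup G] [NormedSpace ℂ G]

/-- ★ **MIXED SECOND DERIVATIVES ALONG AN ADDITIVE DIRECTION VANISH**: if `f` is differentiable near `0` and `f(x + t·v) = f(x) + f(t·v)` for all `(x, t)` near `0`, then
`D²f(0)[u, v] = 0` and `D²f(0)[v, u] = 0` for every `u` — `x ↦ Df(x)v` is locally constant (`= Df(0)v`, the path `t ↦ f(x + tv)` differs from `t ↦ f(tv)` by a constant), and
`t ↦ Df(tv)` is locally constant (`f ∘ (· + tv) = f + const` near `0`).  Stated on `fderiv (fun x => fderiv f x) 0` (no symmetry used; trivial when that map is not differentiable).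
[cite: Balaban1985BackgroundPropagators, (3.14) p.393] -/
theorem fderiv_fderiv_eq_zero_of_add_eventually {f : E → G} {v : E} (hf : ∀ᶠ x in 𝓝 (0 : E), DifferentiableAt ℂ f x)
    (hadd : ∀ᶠ p in 𝓝 (0 : E × ℂ), f (p.1 + p.2 • v) = f p.1 + f (p.2 • v)) (u : E) :
    fderiv ℂ (fun x => fderiv ℂ f x) 0 u v = 0 ∧ fderiv ℂ (fun x => fderiv ℂ f x) 0 v u = 0 := by
  obtain ⟨ε₁, hε₁, h₁⟩ := Metric.eventually_nhds_iff.1 hf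
  obtain ⟨ε₂, hε₂, h₂⟩ := Metric.eventually_nhds_iff.1 hadd
  have hadd' : ∀ (x : E) (t : ℂ), ‖x‖ < ε₂ → ‖t‖ < ε₂ → f (x + t • v) = f x + f (t • v) := fun x t hx ht =>
    @h₂ (x, t) (by rw [dist_zero_right, Prod.norm_def]; exact max_lt hx ht)
  have hdiff : ∀ x : E, ‖x‖ < ε₁ → DifferentiableAt ℂ f x := fun x hx => @h₁ x (by rwa [dist_zero_right])
  have hd0 : DifferentiableAt ℂ f 0 := hdiff 0 (by rw [norm_zero]; exact hε₁)
  set ε : ℝ := min ε₁ ε₂ with hε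
  have hε0 : 0 < ε := lt_min hε₁ hε₂
  -- (i) `x ↦ Df(x)v` is constant near `0`
  have hconst : ∀ x : E, ‖x‖ < ε → fderiv ℂ f x v = fderiv ℂ f 0 v := by
    intro x hx
    have hdx : DifferentiableAt ℂ f x := hdiff x (hx.trans_le (min_le_left _ _))
    have hpx : HasDerivAt (fun t : ℂ => f (x + t • v)) (fderiv ℂ f x v) 0 := by
      have hg : HasDerivAt (fun t : ℂ => x + t • v) v 0 := by simpa using ((hasDerivAt_id (0 : ℂ)).smul_const v).const_add x
      have hF : HasFDerivAt f (fderiv ℂ f x) (x + (0 : ℂ) • v) := by rw [zero_smul, add_zero]; exact hdx.hasFDerivAt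
      exact hF.comp_hasDerivAt (0 : ℂ) hg
    have hp0 : HasDerivAt (fun t : ℂ => f x + f (t • v)) (fderiv ℂ f 0 v) 0 := by
      have hg : HasDerivAt (fun t : ℂ => t • v) v 0 := by simpa using (hasDerivAt_id (0 : ℂ)).smul_const v
      have hF : HasFDerivAt f (fderiv ℂ f 0) ((0 : ℂ) • v) := by rw [zero_smul]; exact hd0.hasFDerivAt
      exact (hF.comp_hasDerivAt (0 : ℂ) hg).const_add (f x)
    have heq : (fun t : ℂ => f (x + t • v)) =ᶠ[𝓝 0] fun t => f x + f (t • v) := by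
      filter_upwards [Metric.ball_mem_nhds (0 : ℂ) hε₂] with t ht
      rw [Metric.mem_ball, dist_zero_right] at ht
      exact hadd' x t (hx.trans_le (min_le_right _ _)) ht
    exact hpx.unique (hp0.congr_of_eventuallyEq heq)
  have hzero₁ : fderiv ℂ (fun x => fderiv ℂ f x v) 0 = 0 := by
    have hev : (fun x => fderiv ℂ f x v) =ᶠ[𝓝 (0 : E)] fun _ => fderiv ℂ f 0 v := by
      filter_upwards [Metric.ball_mem_nhds (0 : E) hε0] with x hx
      rw [Metric.mem_ball, dist_zero_right] at hx
      exact hconst x hx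
    rw [hev.fderiv_eq, fderiv_const_apply]
  -- (ii) `t ↦ Df(t v)` is constant near `0`
  have hconst₂ : ∀ᶠ t : ℂ in 𝓝 0, fderiv ℂ f (t • v) = fderiv ℂ f 0 := by
    have hsmall : ∀ᶠ t : ℂ in 𝓝 0, ‖t • v‖ < ε := by
      have hv0 : 0 < ‖v‖ + 1 := by positivity
      filter_upwards [Metric.ball_mem_nhds (0 : ℂ) (div_pos hε0 hv0)] with t ht
      rw [Metric.mem_ball, dist_zero_right] at ht
      rw [norm_smul]
      calc ‖t‖ * ‖v‖ ≤ ‖t‖ * (‖v‖ + 1) := mul_le_mul_of_nonneg_left (by linarith) (norm_nonneg t)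
        _ < ε / (‖v‖ + 1) * (‖v‖ + 1) := mul_lt_mul_of_pos_right ht hv0
        _ = ε := div_mul_cancel₀ ε hv0.ne'
    filter_upwards [hsmall, Metric.ball_mem_nhds (0 : ℂ) hε₂] with t ht ht2
    rw [Metric.mem_ball, dist_zero_right] at ht2
    have heq : (fun y : E => f (y + t • v)) =ᶠ[𝓝 (0 : E)] fun y => f y + f (t • v) := by
      filter_upwards [Metric.ball_mem_nhds (0 : E) hε₂] with y hy
      rw [Metric.mem_ball, dist_zero_right] at hy
      exact hadd' y t hy ht2
    have h1 : fderiv ℂ f (t • v) = fderiv ℂ (fun y : E => f (y + t • v)) 0 := by rw [fderiv_comp_add_right, zero_add]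
    rw [h1, heq.fderiv_eq, fderiv_add_const]
  have hzero₂ : fderiv ℂ (fun x => fderiv ℂ f x) 0 v = 0 := by
    by_cases hD : DifferentiableAt ℂ (fun x => fderiv ℂ f x) 0
    · have hpath : HasDerivAt (fun t : ℂ => fderiv ℂ f (t • v)) (fderiv ℂ (fun x => fderiv ℂ f x) 0 v) 0 := by
        have hg : HasDerivAt (fun t : ℂ => t • v) v 0 := by simpa using (hasDerivAt_id (0 : ℂ)).smul_const v
        have hF : HasFDerivAt (fun x => fderiv ℂ f x) (fderiv ℂ (fun x => fderiv ℂ f x) 0) ((0 : ℂ) • v) := by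
          rw [zero_smul]; exact hD.hasFDerivAt
        exact hF.comp_hasDerivAt (0 : ℂ) hg
      have hc : HasDerivAt (fun t : ℂ => fderiv ℂ f (t • v)) 0 0 :=
        (hasDerivAt_const (0 : ℂ) (fderiv ℂ f 0)).congr_of_eventuallyEq hconst₂
      exact hpath.unique hc
    · rw [fderiv_zero_of_not_differentiableAt hD, zero_apply]
  refine ⟨?_, by rw [hzero₂, zero_apply]⟩
  by_cases hD : DifferentiableAt ℂ (fun x => fderiv ℂ f x) 0
  · have h := fderiv_clm_apply hD (differentiableAt_const v)
    have h' : fderiv ℂ (fun x => fderiv ℂ f x v) 0 u = fderiv ℂ (fun x => fderiv ℂ f x) 0 u v := by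
      rw [h, fderiv_const_apply, ContinuousLinearMap.comp_zero, zero_add, ContinuousLinearMap.flip_apply]
    rw [← h', hzero₁, zero_apply]
  · rw [fderiv_zero_of_not_differentiableAt hD, zero_apply, zero_apply]

end Calculus

section Abelian

variable {P : Params}

/-- **THE `1∕16` FORM OF ✓`abelianTower_small`** (loops AND stairs of the abelian double-bar tower of `e^{iz}` within `1∕16` of `1` at every level `j < k`, for `|z(b)| ≤ t`,
`32ℓLᵏt ≤ 1`) — the stair clause in the `≤ 1∕8` currency that ✓`eml_algebraMap_mul` consumes. [cite: Balaban1985Averaging, Prop. 4 (134)-(135) p.38; Balaban1984PropagatorsI, (1.18) p.20] -/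
theorem abelianTower_small_sixteenth {k : ℕ} (hk : k ≤ P.m + P.K) (z : PBond P 0 → ℂ) {t : ℝ} (ht0 : 0 ≤ t)
    (hsmall : 32 * ((((P.d + 2) * P.L : ℕ) : ℝ)) * ((P.L : ℝ) ^ k * t) ≤ 1) (hz : ∀ b, ‖z b‖ ≤ t) :
    (∀ j, j < k → ∀ (e : PBond P (j + 1)) (i : Idx P),
        ‖((loopHolU (dbarIterU j (expCfg (𝔸 := ℂ) 1 z)) e i : ℂˣ) : ℂ) - 1‖ ≤ 1 / 16) ∧
    (∀ j, j < k → ∀ (y : Site P (j + 1)) (i : Idx P),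
        ‖((holT (dbarIterU j (expCfg (𝔸 := ℂ) 1 z)) (emb y) (stairWord i.2.1 (off i.1)) : ℂˣ) : ℂ) - 1‖ ≤ 1 / 16) := by
  set ℓ : ℝ := (((P.d + 2) * P.L : ℕ) : ℝ) with hℓ
  have hL1 : (1 : ℝ) ≤ P.L := by exact_mod_cast P.L_pos
  have hℓ0 : 0 ≤ ℓ := by rw [hℓ]; positivity
  have key : ∀ j, j < k → ∀ (x : Site P j) (word : List (Letter P.d)), (walk x word).length ≤ (P.d + 2) * P.L →
      ‖((holT (dbarIterU j (expCfg (𝔸 := ℂ) 1 z)) x word : ℂˣ) : ℂ) - 1‖ ≤ 1 / 16 := by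
    intro j hj x word hlen
    have hjk : j ≤ P.m + P.K := by omega
    have hpow : (P.L : ℝ) ^ j ≤ (P.L : ℝ) ^ k := pow_le_pow_right₀ hL1 hj.le
    have hLj0 : 0 ≤ (P.L : ℝ) ^ j * t := by positivity
    have hLjk : (P.L : ℝ) ^ j * t ≤ (P.L : ℝ) ^ k * t := mul_le_mul_of_nonneg_right hpow ht0
    have hsj : 2 * ℓ * (|(1 : ℝ)| * (P.L : ℝ) ^ j * t) ≤ 1 := by
      rw [abs_one, one_mul]
      nlinarith [mul_le_mul_of_nonneg_left hLjk hℓ0]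
    set w : PBond P j → ℂ := fun b => (Complex.I * ((1 : ℝ) : ℂ)) * (((P.L : ℂ)) ^ j * bondAvgIter j z b) with hw
    have hS : ∀ b : PBond P j, ((dbarIterU j (expCfg (𝔸 := ℂ) 1 z) b : ℂˣ) : ℂ) = Complex.exp (w b) := fun b =>
      dbarIterU_coe_eq_exp_abelian (P := P) 1 j hjk Set.univ z t ht0 hsj (fun b _ _ => hz b) b (Set.mem_univ _) (Set.mem_univ _)
    have hwb : ∀ b : PBond P j, ‖w b‖ ≤ (P.L : ℝ) ^ j * t := fun b => by
      have hQ : ‖bondAvgIter j z b‖ ≤ t :=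
        norm_bondAvgIter_le_tower j hjk Set.univ z t (fun b' _ _ => hz b') b (Set.mem_univ _) (Set.mem_univ _)
      rw [hw]
      dsimp only
      rw [norm_mul, norm_mul, Complex.norm_I, one_mul, Complex.ofReal_one, norm_one, one_mul, norm_mul, norm_pow, Complex.norm_natCast]
      exact mul_le_mul_of_nonneg_left hQ (by positivity)
    have hlenr : ((walk x word).length : ℝ) ≤ ℓ := by rw [hℓ]; exact_mod_cast hlen
    have hprod : ((walk x word).length : ℝ) * ((P.L : ℝ) ^ j * t) ≤ ℓ * ((P.L : ℝ) ^ k * t) :=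
      mul_le_mul hlenr hLjk hLj0 hℓ0
    have hℓk : ℓ * ((P.L : ℝ) ^ k * t) ≤ 1 / 32 := by nlinarith
    have h1 : ((walk x word).length : ℝ) * ((P.L : ℝ) ^ j * t) ≤ 1 := by linarith
    have h2 := norm_holT_sub_one_le_of_exp (dbarIterU j (expCfg (𝔸 := ℂ) 1 z)) w hS hwb x word h1
    linarith
  refine ⟨fun j hj e i => ?_, fun j hj y i => ?_⟩
  · exact key j hj (emb e.src) (loopWord P.L e.dir (off i.1) i.2.1 i.2.2) ((length_walk _ _).le.trans (length_loopWord_le e i))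
  · exact key j hj (emb y) (stairWord i.2.1 (off i.1)) (length_walk_stairWord_le _ _ _)

end Abelian

/-! ## §2 T³: the twisted chart of `A + (iz)·1` against the twisted chart of `A` (displayed tower rows) -/

section T3

variable (F : T3Family) {n K : ℕ} (h : n ≤ K)

/-- ★ **`U̿^{twS}(A + (iz)·1)(c) = ιˣ(U̿^{(k)}(e^{iz})(ĉ)) · U̿^{twS}(A)(c)`** — the re-based twisted double-bar tower of `A + (iz)·1` is the abelian tower of `e^{iz}` (in the centre) times that
of `A`, under the displayed `1∕8`-rows: loops of the perturbed covariant tower `dbarCovIterU j U₀♭ (e^{A}U₀♭)`, its twisted stairs against `Ū₀♭ʲ`, and loops∕stairs of the scalar tower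
(`j < K − n`). [cite: Balaban1985Averaging, (89)-(92) p.31, (127) p.36; Balaban1984PropagatorsI, (1.18) p.20] -/
theorem dbarTwS_add_central (U₀ : GaugeField (F.P K) 0 (Matrix.specialUnitaryGroup (Fin 2) ℂ)) (A : PBond (F.P K) 0 → Matrix (Fin 2) (Fin 2) ℂ)
    (z : PBond (F.P K) 0 → ℂ)
    (hWl : ∀ j, j < K - n → ∀ (c : PBond (F.P K) (j + 1)) (i : Idx (F.P K)),
      ‖((loopHolU (dbarCovIterU j (bgUnits F K U₀) (fun b => expUnit (A b) * bgUnits F K U₀ b)) c i : (Matrix (Fin 2) (Fin 2) ℂ)ˣ) : Matrix (Fin 2) (Fin 2) ℂ) - 1‖ ≤ 1 / 8)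
    (hT : ∀ j, j < K - n → ∀ (y : Site (F.P K) (j + 1)) (i : Idx (F.P K)),
      ‖((tstairU (emlIterU j (bgUnits F K U₀)) (dbarCovIterU j (bgUnits F K U₀) (fun b => expUnit (A b) * bgUnits F K U₀ b)) y i : (Matrix (Fin 2) (Fin 2) ℂ)ˣ) :
        Matrix (Fin 2) (Fin 2) ℂ) - 1‖ ≤ 1 / 8)
    (hsc : ∀ j, j < K - n → ∀ (c : PBond (F.P K) (j + 1)) (i : Idx (F.P K)),
      ‖((loopHolU (dbarIterU j (fun b => expUnit (Complex.I * z b))) c i : ℂˣ) : ℂ) - 1‖ ≤ 1 / 8)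
    (hst : ∀ j, j < K - n → ∀ (y : Site (F.P K) (j + 1)) (i : Idx (F.P K)),
      ‖((holT (dbarIterU j (fun b => expUnit (Complex.I * z b))) (emb y) (stairWord i.2.1 (off i.1)) : ℂˣ) : ℂ) - 1‖ ≤ 1 / 8)
    (c : PBond (F.P n) 0) :
    dbarTwS F n K h U₀ (fun b => A b + (Complex.I * z b) • (1 : Matrix (Fin 2) (Fin 2) ℂ)) c =
      Units.map ((algebraMap ℂ (Matrix (Fin 2) (Fin 2) ℂ) : ℂ →+* Matrix (Fin 2) (Fin 2) ℂ) : ℂ →* Matrix (Fin 2) (Fin 2) ℂ)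
        (dbarIterU (K - n) (fun b => expUnit (Complex.I * z b)) (bondShift (sites_eq F n K h) c)) * dbarTwS F n K h U₀ A c := by
  rw [dbarTwS_eq_dbarCovIterU_mul_inv, dbarTwS_eq_dbarCovIterU_mul_inv, expUnit_add_smul_one_mul,
    dbarCovIterU_centralMul (fun b => expUnit (Complex.I * z b)) (bgUnits F K U₀) (fun b => expUnit (A b) * bgUnits F K U₀ b) (K - n) hWl hsc hT hst, mul_assoc]

/-- ★★ **ADDITIVITY OF THE TWISTED LOG-CHART IN CENTRAL DIRECTIONS**: `log U̿^{twS}(A + (iz)·1)(c) = log U̿^{twS}(A)(c) + (i·Lᵏ·(Q_k z)(ĉ))·1` for `|z(b)| ≤ t`, `32ℓLᵏt ≤ 1`,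
`‖U̿^{twS}(A)(c) − 1‖ ≤ 1∕8`, under the displayed tower rows of `dbarTwS_add_central` (the scalar rows supplied by `abelianTower_small_sixteenth`); `log(ι s·Y) = ι(log s) + log Y`
(✓`mlog_algebraMap_mul`) and the abelian closed form ✓`dbarIterU_coe_eq_exp_abelian`. [cite: Balaban1985Averaging, (125)-(127) p.36, Prop. 4 (134)-(135) p.38; Balaban1984PropagatorsI, (1.18) p.20] -/
theorem logChartTwS_add_central (U₀ : GaugeField (F.P K) 0 (Matrix.specialUnitaryGroup (Fin 2) ℂ)) (A : PBond (F.P K) 0 → Matrix (Fin 2) (Fin 2) ℂ)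
    (z : PBond (F.P K) 0 → ℂ) {t : ℝ} (ht0 : 0 ≤ t)
    (hsmall : 32 * ((((F.P K).d + 2) * (F.P K).L : ℕ) : ℝ) * (((F.P K).L : ℝ) ^ (K - n) * t) ≤ 1) (hz : ∀ b, ‖z b‖ ≤ t)
    (hWl : ∀ j, j < K - n → ∀ (c : PBond (F.P K) (j + 1)) (i : Idx (F.P K)),
      ‖((loopHolU (dbarCovIterU j (bgUnits F K U₀) (fun b => expUnit (A b) * bgUnits F K U₀ b)) c i : (Matrix (Fin 2) (Fin 2) ℂ)ˣ) : Matrix (Fin 2) (Fin 2) ℂ) - 1‖ ≤ 1 / 8)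
    (hT : ∀ j, j < K - n → ∀ (y : Site (F.P K) (j + 1)) (i : Idx (F.P K)),
      ‖((tstairU (emlIterU j (bgUnits F K U₀)) (dbarCovIterU j (bgUnits F K U₀) (fun b => expUnit (A b) * bgUnits F K U₀ b)) y i : (Matrix (Fin 2) (Fin 2) ℂ)ˣ) :
        Matrix (Fin 2) (Fin 2) ℂ) - 1‖ ≤ 1 / 8)
    (c : PBond (F.P n) 0)
    (hA : ‖((dbarTwS F n K h U₀ A c : (Matrix (Fin 2) (Fin 2) ℂ)ˣ) : Matrix (Fin 2) (Fin 2) ℂ) - 1‖ ≤ 1 / 8) :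
    logChartTwS F n K h U₀ (fun b => A b + (Complex.I * z b) • (1 : Matrix (Fin 2) (Fin 2) ℂ)) c =
      logChartTwS F n K h U₀ A c + (Complex.I * ((((F.P K).L : ℂ)) ^ (K - n) * bondAvgIter (K - n) z (bondShift (sites_eq F n K h) c))) • (1 : Matrix (Fin 2) (Fin 2) ℂ) := by
  have hk : K - n ≤ (F.P K).m + (F.P K).K := by show K - n ≤ F.m + K; omega
  set ℓ : ℝ := ((((F.P K).d + 2) * (F.P K).L : ℕ) : ℝ) with hℓ
  have hL1 : (1 : ℝ) ≤ (F.P K).L := by exact_mod_cast (F.P K).L_pos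
  have hℓ1 : (1 : ℝ) ≤ ℓ := by
    rw [hℓ]
    have h1 : 1 ≤ ((F.P K).d + 2) * (F.P K).L := le_trans (Nat.succ_le_of_lt (F.P K).L_pos) (Nat.le_mul_of_pos_left _ (by omega))
    exact_mod_cast h1
  have hLt0 : 0 ≤ ((F.P K).L : ℝ) ^ (K - n) * t := by positivity
  have hLt : ((F.P K).L : ℝ) ^ (K - n) * t ≤ 1 / 32 := by nlinarith
  -- the scalar rows
  obtain ⟨hsc, hst⟩ := abelianTower_small_sixteenth (P := F.P K) hk z ht0 hsmall hz
  rw [expCfg_one_eq_expUnit] at hsc hst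
  -- the abelian closed form on the whole torus
  have h2 : 2 * ℓ * (|(1 : ℝ)| * ((F.P K).L : ℝ) ^ (K - n) * t) ≤ 1 := by rw [abs_one, one_mul]; nlinarith
  have hab := dbarIterU_coe_eq_exp_abelian (P := F.P K) (1 : ℝ) (K - n) hk Set.univ z t ht0 h2
    (fun b _ _ => hz b) (bondShift (sites_eq F n K h) c) (Set.mem_univ _) (Set.mem_univ _)
  rw [expCfg_one_eq_expUnit, Complex.ofReal_one, mul_one] at hab
  set w : ℂ := Complex.I * ((((F.P K).L : ℂ)) ^ (K - n) * bondAvgIter (K - n) z (bondShift (sites_eq F n K h) c)) with hw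
  have hQ : ‖bondAvgIter (K - n) z (bondShift (sites_eq F n K h) c)‖ ≤ t :=
    norm_bondAvgIter_le_tower (K - n) hk Set.univ z t (fun b _ _ => hz b) _ (Set.mem_univ _) (Set.mem_univ _)
  have hwn : ‖w‖ ≤ 1 / 32 := by
    rw [hw, norm_mul, Complex.norm_I, one_mul, norm_mul, norm_pow, Complex.norm_natCast]
    calc ((F.P K).L : ℝ) ^ (K - n) * ‖bondAvgIter (K - n) z (bondShift (sites_eq F n K h) c)‖ ≤ ((F.P K).L : ℝ) ^ (K - n) * t := by gcongr
      _ ≤ 1 / 32 := hLt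
  have hlog2 := Real.log_two_gt_d9
  have hw2 : ‖w‖ < Real.log 2 := by linarith
  have hexp8 : ‖Complex.exp w - 1‖ ≤ 1 / 8 := by
    have h1 : ‖Complex.exp w - 1‖ ≤ 2 * ‖w‖ := Complex.norm_exp_sub_one_le (by linarith)
    linarith
  rw [logChartTwS_apply, logChartTwS_apply,
    dbarTwS_add_central F h U₀ A z hWl hT (fun j hj => hsc j hj |> fun h' c i => (h' c i).trans (by norm_num))
      (fun j hj => hst j hj |> fun h' y i => (h' y i).trans (by norm_num)) c,
    Units.val_mul, Units.coe_map, MonoidHom.coe_coe, hab, mlog_algebraMap_mul hexp8 hA, Complex.exp_eq_exp_ℂ, mlog_exp hw2,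
    Algebra.algebraMap_eq_smul_one, add_comm]

end T3


end Summit.QuantumFields.YangMills.Theorems.Prop7SymAvgTwSym

end
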